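import Summits.RiemannHypothesis.RiemannHypothesis.Theorems.WeilFormatCFamilyGram
import Summits.RiemannHypothesis.RiemannHypothesis.Theorems.WeilFormatCPolyWindowEntryBox
import HarnessLib

/-!
# Format C, design C∞ (E2c, data side): the EXACT-RANGE part of a Hankel family-Gram entry and the range + far-tail split

Route context: Fourier–Galerkin / Schur-complement certificates of Weil positivity on a window ("format C", C∞ door;
cell memo `run/shared/lean/pub/rh-explicit/rh-explicit-weil-2/gen15/E2-PLAN-v2.md` §6; supporting stmt-RiemannHypothesis-0098;
seat rh-explicit-weil-2).  A Hankel entry of the rescaled families (`WeilFormatCCinfGramHankel`) is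
`Σ'_{k≥0} T_t(m₀+k) T_{t'}(m₀+k) (m₀/(m₀+k))^s`; the generator encloses it as EXACT RANGE `m ∈ [m₀, m₀+n)` + FAR TAIL from
`B₄ = m₀+n` (`WeilFormatCCinfGramTails`, `WeilFormatCCinfLogTails`, K-fold Abel for the trig tags).  This file supplies

* `CinfCoeff.rangeEntryBox S A B m₀ n s ∋ Σ_{m ∈ Ico m₀ (m₀+n)} T(m) T'(m) (m₀/m)^s` from per-mode tag boxes `A i ∋ T(m₀+i)`,
  `B i ∋ T'(m₀+i)` (any tags: `1` exactly, `log m` by `MI.logNat`, `C_m`/`S_m` from the prime-phase kit) — `mem_rangeEntryBox`;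
* `CinfCoeff.mem_add_of_range_far` — range box + far-tail box `∋` the whole entry (`tsum_shift_eq_sum_Ico_add_tsum_shift`);
* `CinfCoeff.summable_hankel_term` — the entry's summability from `Σ T²/m² < ∞`, `Σ T'²/m² < ∞` (`s ≥ 2`).

Interval plumbing only; standard axioms; no RH claim.
-/

set_option autoImplicit false
-- `Summit.RiemannHypothesis.RiemannHypothesis.…` is the layout-mandated namespace (summit = problem name).
set_option linter.dupNamespace false

namespace Summit.RiemannHypothesis.RiemannHypothesis.Theorems.WeilFormatC

open Literature.Analysis.ValidatedNumerics Literature.Analysis.ValidatedNumerics.NumericsMP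

namespace CinfCoeff

open WinConst (ratBox mem_ratBox mulRatBox mem_mulRatBox)
open WinEntry (sumBox mem_sumBox)

variable {S : ℕ}

/-! ## The exact range -/

/-- **Exact-range box** `Σ_{i<n} (A i · B i)·(m₀/(m₀+i))^s` (the power is an exact rational, rounded once per term). -/
def rangeEntryBox (S : ℕ) (A B : ℕ → MI) (m₀ n s : ℕ) : MI :=
  sumBox S (fun i ↦ mulRatBox (MI.mul S (A i) (B i)) (((m₀ : ℚ) / ((m₀ : ℚ) + i)) ^ s)) n

/-- **`rangeEntryBox ∋ Σ_{m ∈ Ico m₀ (m₀+n)} T(m)·T'(m)·(m₀/m)^s`** whenever `A i ∋ T(m₀+i)` and `B i ∋ T'(m₀+i)` for `i < n`. -/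
theorem mem_rangeEntryBox (hS : 0 < S) {A B : ℕ → MI} {T T' : ℕ → ℝ} {m₀ n : ℕ}
    (hA : ∀ i < n, MI.mem S (T (m₀ + i)) (A i)) (hB : ∀ i < n, MI.mem S (T' (m₀ + i)) (B i)) (s : ℕ) :
    MI.mem S (∑ m ∈ Finset.Ico m₀ (m₀ + n), T m * T' m * ((m₀ : ℝ) / (m : ℝ)) ^ s)
      (rangeEntryBox S A B m₀ n s) := by
  rw [Finset.sum_Ico_eq_sum_range, Nat.add_sub_cancel_left]
  unfold rangeEntryBox
  refine mem_sumBox n fun i hi ↦ ?_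
  have h := mem_mulRatBox (MI.mem_mul hS (hA i hi) (hB i hi)) (((m₀ : ℚ) / ((m₀ : ℚ) + i)) ^ s)
  have e : (((((m₀ : ℚ) / ((m₀ : ℚ) + i)) ^ s : ℚ)) : ℝ) = ((m₀ : ℝ) / ((m₀ + i : ℕ) : ℝ)) ^ s := by
    push_cast; ring
  rw [e] at h
  exact h

/-! ## Range + far tail -/

/-- **Entry = exact range + far tail**: boxes `R ∋ Σ_{m∈Ico m₀ (m₀+n)} h m` and `F ∋ Σ'_k h(m₀+n+k)` of a sequence summable on
`[m₀, ∞)` give `R + F ∋ Σ'_k h(m₀+k)` — used with `h m = T(m) T'(m) (m₀/m)^s`. -/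
theorem mem_add_of_range_far {h : ℕ → ℝ} {m₀ n : ℕ} (hs : Summable fun k : ℕ ↦ h (m₀ + k)) {R F : MI}
    (hR : MI.mem S (∑ m ∈ Finset.Ico m₀ (m₀ + n), h m) R) (hF : MI.mem S (∑' k : ℕ, h (m₀ + n + k)) F) :
    MI.mem S (∑' k : ℕ, h (m₀ + k)) (R.add F) := by
  rw [tsum_shift_eq_sum_Ico_add_tsum_shift h (Nat.le_add_right m₀ n) hs]
  exact MI.mem_add hR hF

/-- The far tail written at the modes: `Σ'_k T(B₄+k) T'(B₄+k) (m₀/(B₄+k))^s` is `Σ'_k h(B₄+k)` for `h m = T m · T' m · (m₀/m)^s`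
(bookkeeping `rfl`-lemma so that the far-tail boxes of `WeilFormatCCinfLogTails` slot into `mem_add_of_range_far`). -/
theorem far_tail_eq (T T' : ℕ → ℝ) (m₀ B₄ s : ℕ) :
    (∑' k : ℕ, T (B₄ + k) * T' (B₄ + k) * ((m₀ : ℝ) / ((B₄ + k : ℕ) : ℝ)) ^ s)
      = ∑' k : ℕ, (fun m : ℕ ↦ T m * T' m * ((m₀ : ℝ) / (m : ℝ)) ^ s) (B₄ + k) := rfl

/-! ## Summability of an entry -/

/-- `(x·r^j)² ≤ m₀²·(x²/(m₀+k)²)` for `r = m₀/(m₀+k)`, `1 ≤ j`, `1 ≤ m₀`. -/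
private theorem rescaled_sq_le_loc {m₀ : ℕ} (hm₀ : 1 ≤ m₀) (x : ℝ) (k : ℕ) {j : ℕ} (hj : 1 ≤ j) :
    (x * ((m₀ : ℝ) / ((m₀ + k : ℕ) : ℝ)) ^ j) ^ 2 ≤ (m₀ : ℝ) ^ 2 * (x ^ 2 / ((m₀ + k : ℕ) : ℝ) ^ 2) := by
  have hmk : 0 < m₀ + k := by omega
  have hpos : (0 : ℝ) < ((m₀ + k : ℕ) : ℝ) := by exact_mod_cast hmk
  have hr0 : 0 ≤ (m₀ : ℝ) / ((m₀ + k : ℕ) : ℝ) := by positivity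
  have hr1 : (m₀ : ℝ) / ((m₀ + k : ℕ) : ℝ) ≤ 1 := by
    rw [div_le_one hpos]; exact_mod_cast Nat.le_add_right m₀ k
  have hpow : ((m₀ : ℝ) / ((m₀ + k : ℕ) : ℝ)) ^ j ≤ ((m₀ : ℝ) / ((m₀ + k : ℕ) : ℝ)) ^ 1 :=
    pow_le_pow_of_le_one hr0 hr1 hj
  rw [pow_one] at hpow
  calc (x * ((m₀ : ℝ) / ((m₀ + k : ℕ) : ℝ)) ^ j) ^ 2
        = x ^ 2 * (((m₀ : ℝ) / ((m₀ + k : ℕ) : ℝ)) ^ j) ^ 2 := by ring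
    _ ≤ x ^ 2 * ((m₀ : ℝ) / ((m₀ + k : ℕ) : ℝ)) ^ 2 :=
        mul_le_mul_of_nonneg_left (pow_le_pow_left₀ (pow_nonneg hr0 j) hpow 2) (sq_nonneg x)
    _ = (m₀ : ℝ) ^ 2 * (x ^ 2 / ((m₀ + k : ℕ) : ℝ) ^ 2) := by rw [div_pow]; ring

/-- **Summability of a Hankel entry's terms** `T(m₀+k)·T'(m₀+k)·(m₀/(m₀+k))^s` (`s ≥ 2`, `m₀ ≥ 1`) from
`Σ_k T(m₀+k)²/(m₀+k)² < ∞` and `Σ_k T'(m₀+k)²/(m₀+k)² < ∞` (split `s = 1 + (s−1)` and Cauchy–Schwarz termwise). -/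
theorem summable_hankel_term {m₀ : ℕ} (hm₀ : 1 ≤ m₀) {T T' : ℕ → ℝ}
    (hT : Summable fun k : ℕ ↦ T (m₀ + k) ^ 2 / ((m₀ + k : ℕ) : ℝ) ^ 2)
    (hT' : Summable fun k : ℕ ↦ T' (m₀ + k) ^ 2 / ((m₀ + k : ℕ) : ℝ) ^ 2) {s : ℕ} (hs : 2 ≤ s) :
    Summable fun k : ℕ ↦ T (m₀ + k) * T' (m₀ + k) * ((m₀ : ℝ) / ((m₀ + k : ℕ) : ℝ)) ^ s := by
  have h1 : Summable fun k : ℕ ↦ (T (m₀ + k) * ((m₀ : ℝ) / ((m₀ + k : ℕ) : ℝ)) ^ 1) ^ 2 :=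
    Summable.of_nonneg_of_le (fun _ ↦ sq_nonneg _) (fun k ↦ rescaled_sq_le_loc hm₀ _ k le_rfl) (hT.mul_left _)
  have h2 : Summable fun k : ℕ ↦ (T' (m₀ + k) * ((m₀ : ℝ) / ((m₀ + k : ℕ) : ℝ)) ^ (s - 1)) ^ 2 :=
    Summable.of_nonneg_of_le (fun _ ↦ sq_nonneg _) (fun k ↦ rescaled_sq_le_loc hm₀ _ k (by omega))
      (hT'.mul_left _)
  refine (familyGram_summable_mul h1 h2).congr fun k ↦ ?_
  have e : s = 1 + (s - 1) := by omega
  conv_rhs => rw [e, pow_add]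
  ring

end CinfCoeff

end Summit.RiemannHypothesis.RiemannHypothesis.Theorems.WeilFormatC
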